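import Summits.CriticalPhenomena.PercolationContinuityZ3.Theorems.PercNearOneGluingNoHeavyQuantHubProfileCore
import Summits.CriticalPhenomena.PercolationContinuityZ3.Theorems.PercNearOneGluingNoHeavyQuantHubProfileBridge
import Summits.CriticalPhenomena.PercolationContinuityZ3.Theorems.PercNearOneGluingNoHeavyQuantTwoPointHubVertex
import Summits.CriticalPhenomena.PercolationContinuityZ3.Theorems.PercNearOneGluingNoHeavyQuantIndepBlobHalfRow
import Summits.CriticalPhenomena.PercolationContinuityZ3.Theorems.PercNearOneGluingNoHeavyQuantIndepBlobFarMin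
import Summits.CriticalPhenomena.PercolationContinuityZ3.Theorems.PercNearOneGluingNoHeavyQuantMonoHubOneBlock
import Summits.CriticalPhenomena.PercolationContinuityZ3.Theorems.PercNearOneGluingNoHeavyQuantHubBlocksProfileConjecture
import Summits.CriticalPhenomena.PercolationContinuityZ3.Theorems.PercNearOneGluingNoHeavyQuantFarTreeHubBlocksFar
import HarnessLib

/-!
# QUANT lane R8, FAR on trees: the PROFILE CONJECTURE (★) `Quant.HubBlocksProfileIneq` is a THEOREM

builds on p205010 (kernel theorem, internal audit signed; external expert review pending)

Support file (`--supports stmt-CriticalPhenomena-4575`), QUANT lane typer seat prim-quant-stmt (gen 15): the assembly asked for by lead g12 (LEAD-NOTES-G12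
(5)(A)) and census-2 g47 (HANDOFF (b)).  Theorems only; no definitions, no sorries, standard axioms.

* `Quant.hubBlocksProfileIneq_holds : Quant.HubBlocksProfileIneq` — census-1 gen 10's proof (PROFILE-PROOF-G10 §2–§5/§11) assembled: the block tail of
  the conjecture is read as an independent-blob system on the live block coordinates (`Quant.real_blockTail_eq_sum_subtype`, `…QuantHubProfileBridge`);
  the four blob-sum rows are the kernel theorems `IndepBlob.hubMixture_far` (K4, census-2 g47), `IndepBlob.far_indepBlob_min` (block-star FAR, lead g5 /
  p1), `IndepBlob.halfRow` (census-2 g46), `IndepBlob.twoPointHub_vertex` ((B-4), census-1 g11 + census-2 g47); the price / certificate / pairing /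
  induction on the hub top is `Quant.profile_core` (`…QuantHubProfileCore`); the pure star `K = ∅` is stmt g13's `Quant.hubBlocksProfileIneq_mono_empty`.
* Consequences already in the tree become unconditional: `Quant.farTree_hubBlocks_of_hubBlocksProfileIneq` (FAR at every layer for 'hub + leaves + ANY
  root blocks', `…QuantHubBlocksProfileConjecture`) — `Quant.farTree_hubBlocks_profile` below; likewise the route-vocabulary rows of
  `…QuantFarTreeHubBlocksProfile.lean` / `…QuantMonoProfileConjectures.lean` that took (★) as a hypothesis.
[this work]; [cite: KozmaNitzan2024, Conjecture 3 (p. 15)] (the gluing rows served).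
-/

noncomputable section

namespace Summit.CriticalPhenomena.PercolationContinuityZ3.Theorems

namespace Quant

open Finset MeasureTheory
open Literature.Probability.LatticeModels
open Literature.Probability.Percolation
open scoped Classical

/-- **THEOREM (★).**  The profile conjecture `Quant.HubBlocksProfileIneq` holds. [this work] -/
theorem hubBlocksProfileIneq_holds : HubBlocksProfileIneq := by
  intro n q K size m p μ G τ j hp0 hsum hmean hμ hratio hG0 hG1 hEN hτ hτK
  -- restrict to the live blocks (size ≥ 1): the block sum and the mean do not see the others
  set K' : Finset (Fin n) := K.filter (fun x => 1 ≤ size x) with hK'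
  have hK'K : K' ⊆ K := Finset.filter_subset _ _
  have hWK : ∀ ω : Set (Fin n), ∑ x ∈ K.filter (fun x => x ∈ ω), size x = ∑ x ∈ K'.filter (fun x => x ∈ ω), size x := by
    intro ω
    have : K'.filter (fun x => x ∈ ω) = (K.filter (fun x => x ∈ ω)).filter (fun x => 1 ≤ size x) := by
      rw [hK', Finset.filter_filter, Finset.filter_filter]
      exact Finset.filter_congr fun x _ => and_comm
    rw [this]
    exact (Finset.sum_filter_of_ne fun x _ hx => Nat.one_le_iff_ne_zero.2 hx).symm
  have hev : ∀ y : ℕ, {ω : Set (Fin n) | y ≤ ∑ x ∈ K.filter (fun x => x ∈ ω), size x} =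
      {ω : Set (Fin n) | y ≤ ∑ x ∈ K'.filter (fun x => x ∈ ω), size x} := fun y => by
    ext ω; simp only [Set.mem_setOf_eq, hWK ω]
  have hEN' : (2 * j : ℝ) < (∑ x ∈ K', (size x : ℝ) * (q x : ℝ)) + G * μ := by
    have : ∑ x ∈ K', (size x : ℝ) * (q x : ℝ) = ∑ x ∈ K, (size x : ℝ) * (q x : ℝ) := by
      rw [hK', Finset.sum_filter_of_ne]
      intro x _ hx
      by_contra h0
      push Not at h0
      have : size x = 0 := by omega
      rw [this] at hx; simp at hx
    rw [this]; exact hEN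
  simp only [hev]
  -- the pure star
  by_cases hKe : K' = ∅
  · rw [hKe] at hEN' ⊢
    exact hubBlocksProfileIneq_mono_empty q size m p μ G τ j hp0 hsum hmean hμ (mono_of_ratioRegular p μ hμ hp0 hratio) hG0 hG1 hEN' hτ
  -- the blocks as an independent-blob system on `↥K'`
  obtain ⟨x₀, hx₀⟩ := Finset.nonempty_iff_ne_empty.2 hKe
  set pK : K' → ℝ := fun k => ((q k : unitInterval) : ℝ) with hpK
  set aK : K' → ℕ := fun k => size k with haK
  have hp0K : ∀ k, 0 ≤ pK k := fun k => (q k).2.1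
  have hp1K : ∀ k, pK k ≤ 1 := fun k => (q k).2.2
  have haK1 : ∀ k : K', 1 ≤ aK k := fun k => (Finset.mem_filter.1 k.2).2
  obtain ⟨y₀, -, hy₀⟩ := Finset.exists_min_image (Finset.univ : Finset K') pK ⟨⟨x₀, hx₀⟩, Finset.mem_univ _⟩
  have hy₀' : ∀ k, pK y₀ ≤ pK k := fun k => hy₀ k (Finset.mem_univ _)
  set g : ℝ := pK y₀ with hg
  set EW : ℝ := ∑ k : K', (aK k : ℝ) * pK k with hEW
  have hEWK : EW = ∑ x ∈ K', (size x : ℝ) * (q x : ℝ) := by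
    rw [hEW]; exact Finset.sum_coe_sort K' (fun x => (size x : ℝ) * (q x : ℝ))
  set TW0 : ℝ := ∑ T ∈ (Finset.univ : Finset (Finset K')).filter (fun T : Finset K' => j + 1 ≤ ∑ k ∈ T, size k),
      ∏ k : K', (if k ∈ T then ((q k : unitInterval) : ℝ) else 1 - ((q k : unitInterval) : ℝ)) with hTW0
  set TWs : ℕ → ℝ := fun M => ∑ T ∈ (Finset.univ : Finset (Finset K')).filter (fun T : Finset K' => j + 1 ≤ M + ∑ k ∈ T, size k),
      ∏ k : K', (if k ∈ T then ((q k : unitInterval) : ℝ) else 1 - ((q k : unitInterval) : ℝ)) with hTWs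
  -- the conjecture's probabilities are these sums
  simp only [real_blockTail_shift_eq_sum_subtype]
  simp only [real_blockTail_eq_sum_subtype]
  have hw0 : ∀ T : Finset K', 0 ≤ ∏ k : K', (if k ∈ T then ((q k : unitInterval) : ℝ) else 1 - ((q k : unitInterval) : ℝ)) :=
    IndepBlob.bernoulliWeight_nonneg hp0K hp1K
  -- abstract properties of `TW0`, `TWs`
  have hTW0nn : 0 ≤ TW0 := Finset.sum_nonneg fun T _ => hw0 T
  have hTWs0 : ∀ M, TW0 ≤ TWs M := fun M =>
    Finset.sum_le_sum_of_subset_of_nonneg (fun T hT => by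
      rw [Finset.mem_filter] at hT ⊢; exact ⟨hT.1, le_trans hT.2 (Nat.le_add_left _ _)⟩) fun T _ _ => hw0 T
  have hTWsz : TWs 0 = TW0 := by
    simp only [hTWs, hTW0, zero_add]
  have hTWtop : ∀ M, j + 1 ≤ M → TWs M = 1 := by
    intro M hM
    simp only [hTWs]
    rw [Finset.filter_true_of_mem fun T _ => le_trans hM (Nat.le_add_right _ _)]
    exact IndepBlob.sum_bernoulliWeight pK
  have hs1 : (((j + 1 : ℕ) : ℝ) - 1) = j := by push_cast; ring
  have hEN2 : 2 * (j : ℝ) < G * μ + EW := by rw [hEWK]; linarith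
  -- the four row families
  have hH : ∀ M : ℕ, 1 ≤ M → G * μ ≤ M → min (G * μ / M) g ≤ G * μ / M * TWs M + (1 - G * μ / M) * TW0 := by
    intro M hM hGM
    have hM0 : (0 : ℝ) < M := by exact_mod_cast hM
    have h := IndepBlob.hubMixture_far pK aK hp0K hp1K y₀ hy₀' (G * μ / M) (div_nonneg (by nlinarith [hμ.le, hG0.le]) hM0.le)
      ((div_le_one hM0).2 hGM) M (j + 1) (by
        have : (M : ℝ) * (G * μ / M) = G * μ := by field_simp
        rw [this, hs1]; linarith [hEN2, hEW])
    simpa [hTWs, hTW0, haK, hpK] using h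
  have hF : ∀ i : ℕ, 2 * ((((j + 1 : ℕ) : ℝ)) - 1 - i) < EW → g ≤ TWs i := by
    intro i hi
    have h := IndepBlob.far_indepBlob_min pK (fun k => (aK k : ℝ)) hp0K hp1K (fun k => Nat.cast_nonneg _) y₀ hy₀'
      ((((j + 1 : ℕ) : ℝ)) - 1 - i) (by rw [hEW] at hi; linarith)
    -- complement: `{Σ a ≤ s − 1 − i} = {¬ (s ≤ i + Σ a)}`
    have hcompl : (Finset.univ : Finset (Finset K')).filter (fun T : Finset K' => ∑ k ∈ T, ((aK k : ℕ) : ℝ) ≤ (((j + 1 : ℕ) : ℝ)) - 1 - i) =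
        (Finset.univ : Finset (Finset K')).filter (fun T : Finset K' => ¬ (j + 1 ≤ i + ∑ k ∈ T, size k)) := by
      refine Finset.filter_congr fun T _ => ?_
      have e : ∑ k ∈ T, ((aK k : ℕ) : ℝ) = ((∑ k ∈ T, size (k : Fin n) : ℕ) : ℝ) := by push_cast; rfl
      rw [e]
      constructor
      · intro h1 h2
        have : ((j + 1 : ℕ) : ℝ) ≤ ((i + ∑ k ∈ T, size (k : Fin n) : ℕ) : ℝ) := by exact_mod_cast h2
        push_cast at this h1; linarith
      · intro h1
        push Not at h1
        have : ((i + ∑ k ∈ T, size (k : Fin n) : ℕ) : ℝ) + 1 ≤ ((j + 1 : ℕ) : ℝ) := by exact_mod_cast h1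
        push_cast at this ⊢; linarith
    rw [hcompl] at h
    have htot := Finset.sum_filter_add_sum_filter_not (Finset.univ : Finset (Finset K'))
      (fun T : Finset K' => j + 1 ≤ i + ∑ k ∈ T, size k)
      (fun T => ∏ k : K', (if k ∈ T then pK k else 1 - pK k))
    rw [IndepBlob.sum_bernoulliWeight pK] at htot
    simp only [hTWs, hpK] at htot ⊢
    linarith
  have hHR : ∀ k : ℕ, 2 * ((((j + 1 : ℕ) : ℝ)) - k) - 3 < EW → g / 2 ≤ TWs k := by
    intro k hk
    have hEW0 : 0 ≤ EW := Finset.sum_nonneg fun k _ => mul_nonneg (Nat.cast_nonneg _) (hp0K k)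
    have h := IndepBlob.halfRow pK aK hp0K hp1K haK1 y₀ hy₀' (j + 1 - k) (by
      rw [hEW] at hk hEW0
      rcases le_or_gt k (j + 1) with hkj | hkj
      · have : (((j + 1 - k : ℕ)) : ℝ) = ((j + 1 : ℕ) : ℝ) - k := by push_cast [Nat.cast_sub hkj]; ring
        rw [this]; exact hk
      · have : j + 1 - k = 0 := by omega
        rw [this]; push_cast; linarith)
    have hcongr : (Finset.univ : Finset (Finset K')).filter (fun T : Finset K' => j + 1 - k ≤ ∑ i ∈ T, aK i) =
        (Finset.univ : Finset (Finset K')).filter (fun T : Finset K' => j + 1 ≤ k + ∑ i ∈ T, size i) := by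
      refine Finset.filter_congr fun T _ => ?_
      simp only [haK]
      omega
    rw [hcongr] at h
    simpa [hTWs, hpK] using h
  have hV : ∀ k M : ℕ, 1 ≤ k → M + 1 ≤ j + 1 → μ < M → 2 * (k : ℝ) < G * μ → G * μ < 2 * (k : ℝ) + 1 →
      min (G * μ / M) g ≤ (1 - G) * TW0 + G * (((M : ℝ) - μ) / ((M : ℝ) - k)) * TWs k + G * ((μ - k) / ((M : ℝ) - k)) * TWs M := by
    intro k M hk hMs hμM h2k h2k1
    have h := IndepBlob.twoPointHub_vertex pK aK hp0K hp1K haK1 y₀ hy₀' k M (j + 1) G μ hk hMs hG0.le hG1 hμM h2k h2k1 (by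
      push_cast; linarith [hEN2, hEW])
    simpa [hTWs, hTW0, haK, hpK] using h
  -- the abstract core
  have hy₀K : (y₀ : Fin n) ∈ K := hK'K y₀.2
  have hτg : G * τ ≤ g := hτK y₀ hy₀K
  have hcore := profile_core (j + 1) μ G g EW TW0 TWs hμ hG0 hG1 hTW0nn hTWs0 hTWsz hTWtop
    (by rw [hs1, hEWK]; linarith) hH hF hHR hV m p τ hp0 hsum hmean hratio hτ hτg
  simpa [hTWs, hTW0] using hcore

variable {n : ℕ} in
/-- **FAR at every layer for 'hub + leaves + ANY root blocks' — now UNCONDITIONAL** (`Quant.farTree_hubBlocks_of_hubBlocksProfileIneq` applied to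
`hubBlocksProfileIneq_holds`).  Setting of `Quant.farTree_hubBlocks`: observer `o`; hub `h` with leaf relays `L`; block vertices `K` (parent `o`) with
gate-`1` tails `B b`; relays `A = L ∪ ⋃_{b∈K}({b} ∪ B b)`; any gates.  If `2j < q h·Σ_{ℓ∈L} q ℓ + Σ_{b∈K} q b·(|B b|+1)` (`= Σ_{a∈A} P(a reached)`),
`1 − q b ≤ t` on `K` and `1 − q h·q ℓ₀ ≤ t` for a least reliable leaf `ℓ₀`, then `P(#{a ∈ A counted} ≤ j) ≤ t`. [this work] -/
theorem farTree_hubBlocks_profile (q : Fin n → unitInterval) (o h ℓ₀ : Fin n)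
    (L K : Finset (Fin n)) (B : Fin n → Finset (Fin n)) (depth : Fin n → ℕ) (par : Fin n → Fin n) (j : ℕ) (t : ℝ)
    (hK : ∀ b ∈ K, par b = o ∧ depth b = 0)
    (hL : ∀ a ∈ L, par a = h ∧ depth a = 1) (hB : ∀ b ∈ K, ∀ a ∈ B b, par a = b ∧ depth a = 1)
    (hhL : h ∉ L) (hhK : h ∉ K) (hLK : Disjoint L K) (hLB : ∀ b ∈ K, Disjoint L (B b))
    (hKB : ∀ b ∈ K, ∀ b' ∈ K, b ∉ B b') (hBB : ∀ b ∈ K, ∀ b' ∈ K, b ≠ b' → Disjoint (B b) (B b'))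
    (hqB : ∀ b ∈ K, ∀ a ∈ B b, q a = 1) (hℓ₀ : ℓ₀ ∈ L) (hmin : ∀ a ∈ L, (q ℓ₀ : ℝ) ≤ q a) (hqℓ₀ : 0 < (q ℓ₀ : ℝ))
    (hEN : (2 * j : ℝ) < (q h : ℝ) * ∑ a ∈ L, (q a : ℝ) + ∑ b ∈ K, (q b : ℝ) * (((B b).card : ℝ) + 1))
    (htK : ∀ b ∈ K, 1 - (q b : ℝ) ≤ t) (htℓ : 1 - (q h : ℝ) * q ℓ₀ ≤ t) :
    (prodBernoulli q).real {ω' : Set (Fin n) |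
      ((L ∪ K.biUnion fun b => insert b (B b)).filter
        fun a => a = o ∨ ∀ i, i ≤ depth a → par^[i] a ∈ ω').card ≤ j} ≤ t :=
  farTree_hubBlocks_of_hubBlocksProfileIneq hubBlocksProfileIneq_holds q o h ℓ₀ L K B depth par j t hK hL hB hhL hhK hLK hLB hKB hBB hqB
    hℓ₀ hmin hqℓ₀ hEN htK htℓ

variable {n : ℕ} in
/-- **FAR for 'hub + leaves + ANY root blocks' in the ROUTE vocabulary (bond percolation with tree-supported weights on `Sym2 (Fin n)`), any gates.**
Weights `w` supported on a rooted tree (`par`/`depth` as in `Quant.tree_relayCount_transfer`) in which the hub `h` and the block vertices `b ∈ K` are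
children of the observer `o`, the leaf relays `L` are children of `h`, and the block relays `B b` are children of `b` glued by weight `1`; NO common
gate, NO regime.  Then the body of `Quant.FarRelayRow` holds for `A = L ∪ ⋃_b ({b} ∪ B b)` at every layer `j`: `2j < Σ_{a∈A} P_w(o ↔ a)` and
`P_w(o ↮ a) ≤ t` on `A` imply `P_w(#{a ∈ A | o ↔ b} ≤ j) ≤ t` — the pattern of `Quant.farRelayRow_hubBlocks_commonGate` (stmt g11) with
`farTree_hubBlocks_profile` in place of the common-gate row. [this work] -/
theorem farRelayRow_hubBlocks_profile (w : Sym2 (Fin n) → unitInterval) (o h ℓ₀ : Fin n) (L K : Finset (Fin n))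
    (B : Fin n → Finset (Fin n)) (depth : Fin n → ℕ) (par : Fin n → Fin n) (j : ℕ) (t : ℝ)
    (hroot : ∀ x, x ≠ o → depth x = 0 → par x = o)
    (hstep : ∀ x, x ≠ o → depth x ≠ 0 → par x ≠ o ∧ depth (par x) + 1 = depth x)
    (hsupp : ∀ e, w e ≠ 0 → e.IsDiag ∨ ∃ x, x ≠ o ∧ e = s(par x, x))
    (hho : h ≠ o) (hoK : o ∉ K) (hoL : o ∉ L) (hoB : ∀ b ∈ K, o ∉ B b) (hh : depth h = 0)
    (hK : ∀ b ∈ K, par b = o ∧ depth b = 0)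
    (hL : ∀ a ∈ L, par a = h ∧ depth a = 1) (hB : ∀ b ∈ K, ∀ a ∈ B b, par a = b ∧ depth a = 1)
    (hhL : h ∉ L) (hhK : h ∉ K) (hLK : Disjoint L K) (hLB : ∀ b ∈ K, Disjoint L (B b))
    (hKB : ∀ b ∈ K, ∀ b' ∈ K, b ∉ B b') (hBB : ∀ b ∈ K, ∀ b' ∈ K, b ≠ b' → Disjoint (B b) (B b'))
    (hℓ₀ : ℓ₀ ∈ L) (hmin : ∀ a ∈ L, (w s(h, ℓ₀) : ℝ) ≤ w s(h, a)) (hwB : ∀ b ∈ K, ∀ a ∈ B b, (w s(b, a) : ℝ) = 1)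
    (hEN : (2 * j : ℝ) < ∑ a ∈ L ∪ K.biUnion (fun b => insert b (B b)), (prodBernoulli w).real (openConn o a))
    (ht : ∀ a ∈ L ∪ K.biUnion (fun b => insert b (B b)),
      (prodBernoulli w).real (openConn o a : Set (BondConfig (Fin n)))ᶜ ≤ t) :
    (prodBernoulli w).real {ω : BondConfig (Fin n) |
      ((L ∪ K.biUnion fun b => insert b (B b)).filter fun a => ω ∈ openConn o a).card ≤ j} ≤ t := by
  have hmeasW : ∀ S : Set (BondConfig (Fin n)), MeasurableSet S := fun S => (Set.toFinite S).measurableSet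
  -- the degenerate leaf `w(h, ℓ₀) = 0`: the cut at `ℓ₀` forces `t ≥ 1`
  have htℓ0 := ht ℓ₀ (Finset.mem_union_left _ hℓ₀)
  rw [tree_relayCount_transfer n w o depth par hroot hstep hsupp (L ∪ K.biUnion fun b => insert b (B b)) j]
  set q : Fin n → unitInterval := fun x => if x = o then 1 else w s(par x, x) with hq
  have hph : par h = o := hroot h hho hh
  have hqh : q h = w s(o, h) := by simp only [hq, if_neg hho, hph]
  have hbo : ∀ b ∈ K, b ≠ o := fun b hb hbo => hoK (hbo ▸ hb)
  have hqb : ∀ b ∈ K, q b = w s(o, b) := by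
    intro b hb
    simp only [hq, if_neg (hbo b hb), (hK b hb).1]
  have hqL : ∀ a ∈ L, q a = w s(h, a) := by
    intro a ha
    have hao : a ≠ o := fun hao => hoL (hao ▸ ha)
    simp only [hq, if_neg hao, (hL a ha).1]
  have hqB : ∀ b ∈ K, ∀ a ∈ B b, q a = 1 := by
    intro b hb a ha
    have hao : a ≠ o := fun hao => hoB b hb (hao ▸ ha)
    have h1 : (q a : ℝ) = 1 := by
      simp only [hq, if_neg hao, (hB b hb a ha).1]
      exact hwB b hb a ha
    exact Subtype.ext (by exact_mod_cast h1)
  -- marginals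
  have hmL : ∀ a ∈ L, (prodBernoulli w).real (openConn o a) = (q h : ℝ) * q a := by
    intro a ha
    have hao : a ≠ o := fun hao => hoL (hao ▸ ha)
    rw [tree_real_openConn_eq_prod n w o depth par hroot hstep hsupp a hao, (hL a ha).2,
      Finset.prod_range_succ, Finset.prod_range_one, Function.iterate_zero_apply, Function.iterate_one,
      (hL a ha).1, hph, hqh, hqL a ha, mul_comm]
  have hmb : ∀ b ∈ K, (prodBernoulli w).real (openConn o b) = q b := by
    intro b hb
    rw [tree_real_openConn_eq_prod n w o depth par hroot hstep hsupp b (hbo b hb), (hK b hb).2, Finset.prod_range_one,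
      Function.iterate_zero_apply, (hK b hb).1, hqb b hb]
  have hmB : ∀ b ∈ K, ∀ a ∈ B b, (prodBernoulli w).real (openConn o a) = q b := by
    intro b hb a ha
    have hao : a ≠ o := fun hao => hoB b hb (hao ▸ ha)
    rw [tree_real_openConn_eq_prod n w o depth par hroot hstep hsupp a hao, (hB b hb a ha).2,
      Finset.prod_range_succ, Finset.prod_range_one, Function.iterate_zero_apply, Function.iterate_one,
      (hB b hb a ha).1, (hK b hb).1, hqb b hb, hwB b hb a ha, one_mul]
  -- the relay set as a disjoint union
  have hdisjLK' : Disjoint L (K.biUnion fun b => insert b (B b)) := by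
    rw [Finset.disjoint_biUnion_right]
    intro b hb
    rw [Finset.disjoint_insert_right]
    exact ⟨fun hbL => Finset.disjoint_left.1 hLK hbL hb, hLB b hb⟩
  have hpair : ∀ b ∈ K, ∀ b' ∈ K, b ≠ b' → Disjoint (insert b (B b)) (insert b' (B b')) := by
    intro b hb b' hb' hbb'
    rw [Finset.disjoint_left]
    intro a ha ha'
    rcases Finset.mem_insert.1 ha with rfl | haB
    · rcases Finset.mem_insert.1 ha' with hab' | haB'
      · exact hbb' hab'
      · exact hKB a hb b' hb' haB'
    · rcases Finset.mem_insert.1 ha' with rfl | haB'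
      · exact hKB a hb' b hb haB
      · exact Finset.disjoint_left.1 (hBB b hb b' hb' hbb') haB haB'
  -- the mean hypothesis in gate form
  have hEN' : (2 * j : ℝ) < (q h : ℝ) * ∑ a ∈ L, (q a : ℝ) + ∑ b ∈ K, (q b : ℝ) * (((B b).card : ℝ) + 1) := by
    rw [Finset.sum_union hdisjLK', Finset.sum_biUnion (fun b hb b' hb' hbb' => hpair b hb b' hb' hbb'),
      Finset.sum_congr rfl hmL, ← Finset.mul_sum] at hEN
    have hblocks : ∑ b ∈ K, ∑ a ∈ insert b (B b), (prodBernoulli w).real (openConn o a) =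
        ∑ b ∈ K, (q b : ℝ) * (((B b).card : ℝ) + 1) := by
      refine Finset.sum_congr rfl fun b hb => ?_
      rw [Finset.sum_insert (hKB b hb b hb), hmb b hb, Finset.sum_congr rfl (hmB b hb), Finset.sum_const, nsmul_eq_mul]
      ring
    rw [hblocks] at hEN
    exact hEN
  -- cuts
  have htK : ∀ b ∈ K, 1 - (q b : ℝ) ≤ t := by
    intro b hb
    have := ht b (Finset.mem_union_right _ (Finset.mem_biUnion.2 ⟨b, hb, Finset.mem_insert_self _ _⟩))
    rw [probReal_compl_eq_one_sub (hmeasW _), hmb b hb] at this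
    exact this
  have htℓ : 1 - (q h : ℝ) * (q ℓ₀ : ℝ) ≤ t := by
    rw [probReal_compl_eq_one_sub (hmeasW _), hmL ℓ₀ hℓ₀] at htℓ0
    exact htℓ0
  have hmin' : ∀ a ∈ L, (q ℓ₀ : ℝ) ≤ q a := by
    intro a ha
    rw [hqL ℓ₀ hℓ₀, hqL a ha]
    exact hmin a ha
  rcases eq_or_lt_of_le (q ℓ₀).2.1 with hq0 | hqpos
  · -- `q ℓ₀ = 0`: `t ≥ 1`
    have ht1 : 1 ≤ t := by rw [← hq0, mul_zero, sub_zero] at htℓ; exact htℓ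
    exact measureReal_le_one.trans ht1
  exact farTree_hubBlocks_profile q o h ℓ₀ L K B depth par j t hK hL hB hhL hhK hLK hLB hKB hBB hqB hℓ₀ hmin' hqpos hEN' htK htℓ

end Quant

end Summit.CriticalPhenomena.PercolationContinuityZ3.Theorems

end
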